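import Mathlib
import Literature.Analysis.DeBrangesSpaces.CubicStructureHamiltonian
import HarnessLib

/-!
# The structure Hamiltonian `H₀` of the cubic `E₀` and its fundamental solution (Suzuki 2023, §12.2–§12.3)

Part 2 of the kernel-checked transcription, AS PRINTED, of the worked example of M. Suzuki,
*Analytic theories around the simplest screw*, arXiv:2308.11860 (2023) [Suzuki2023SimplestScrew],
§12.2–§12.3 (Part 1, `CubicStructureHamiltonian.lean`: `E₀`, `A, B, C, D`, `W₀`, its factorisation,
(12.2)–(12.4), `E₀, A − iB ∈ HB`). Here, from the factor data `(α,β,γ) = (0,0,½), (4,0,0), (0,0,½)` of §12.3: the times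
`t₀ = 0, t₁ = ½, t₂ = ½ + 4, t₃ = ½ + 4 + ½` (`t_k = t_{k−1} + αₖ + γₖ`), the locally constant
Hamiltonian (12.7) `H₀ = diag(0,1)` on `[t₀,t₁) ∪ [t₂,t₃]` (indivisible intervals of type `π/2`),
`diag(1,0)` on `[t₁,t₂)` (type `0`) — `H = [[α,β],[β,γ]]/(α+γ)` — and the PRINTED piecewise
`A(t,z), B(t,z), C(t,z), D(t,z)`; theorems: the three branches are the steps of the inductive formula
(12.6) `W(t,z) = W(t_{k−1},z)(I − z(t − t_{k−1}) H_k J)`, they glue continuously at `t₁, t₂`,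
`W(0,z) = I`, `W(t₃,z) = W₀(z)` («recovers `W₀(z)` at `t = t₃`»), `det W(t,z) = 1`, and the canonical
system (12.5) `(d/dt)[W(t,z)J] = z W(t,z) H₀(t)` holds at every `t ∈ (t₀,t₃) ∖ {t₁,t₂}` (the
regular points being `{t₀,t₁,t₂,t₃}`); finally the chain `E₀(t,z) := C(t,z) − iD(t,z)` at
`t₃, t₂, t₁, t₀`. RH-FREE; a worked polynomial example (cell `rh-dbr` STEP-0 anchor P4 in kernel form);
nothing here bears on the Riemann Hypothesis.

## Design choices
* The matrix ODE (12.5) is stated ENTRYWISE (`HasDerivAt` of each entry of `t ↦ W(t,z)J`; Mathlib has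
  no global norm on `Matrix` and statement files may not add local instances): on each open interval
  `W(s,z)J` is affine in `s` (`W_mul_J_affine₁₂₃`), so the derivative is read off and compared with
  `z·W(t,z)H₀(t)` as literal matrices (all `2 × 2` algebra via `Matrix.mul_fin_two`).
* The printed case split defines `H₀`, `A(t,z)…D(t,z)` on `[0,5]` only; below, the first branch is
  extended to all `t < ½` and the last to all `t ≥ 9/2` (junk outside `[0,5]`, documented).
* Misprints in the source: (12.6) prints `αₖ + λₖ` for `αₖ + γₖ`; the closing list of de Branges
  subspaces prints `E(t₁,z) = −z/2 + i`, `E(t₂,z) = −z/2 + (2z² − 1)`, `E(t₀,z) = 1`, whereas the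
  printed `C, D` give `C − iD = −z/2 − i`, `−z/2 − i(1 − 2z²)`, `−i` (`Esol_values`).

## Deliberately NOT here
Thm. 12.1 (= de Branges 1968, Thms. 35/40) and the identification of the de Branges subspaces
`𝓗(E(t₃)) ≃ ℂ³ ⊃ 𝓗(E(t₂)) ≃ ℂ² ⊃ 𝓗(E(t₁)) = ℂ ⊃ {0}` (needs `𝓗(E)` of a polynomial `E`, not in
the tree); reparameterisation classes of Hamiltonians (Def. 12.2). Reference:
[Suzuki2023SimplestScrew] §12.2 (12.5)–(12.6), §12.3 (12.7) and the displayed `W(t,z)`.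
-/

noncomputable section
namespace Literature.Analysis.DeBrangesSpaces
namespace SimplestScrewCubic
open _root_.Complex
open scoped ComplexConjugate

/-- Entrywise equality of literal `2 × 2` matrices (private copy of Part 1's helper). [folklore] -/
private theorem mat2_ext {a b c d a' b' c' d' : ℂ} (h₁ : a = a') (h₂ : b = b') (h₃ : c = c')
    (h₄ : d = d') : !![a, b; c, d] = !![a', b'; c', d'] := by
  subst h₁ h₂ h₃ h₄; rfl

/-- Scalar multiple of a literal `2 × 2` matrix. [folklore] -/
private theorem smul_mat2 (k a b c d : ℂ) : k • !![a, b; c, d] = !![k * a, k * b; k * c, k * d] := by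
  ext i j; fin_cases i <;> fin_cases j <;> simp

/-- Sum of literal `2 × 2` matrices. [folklore] -/
private theorem add_mat2 (a b c d a' b' c' d' : ℂ) :
    !![a, b; c, d] + !![a', b'; c', d'] = !![a + a', b + b'; c + c', d + d'] := by
  ext i j; fin_cases i <;> fin_cases j <;> simp

/-- Difference of literal `2 × 2` matrices. [folklore] -/
private theorem sub_mat2 (a b c d a' b' c' d' : ℂ) :
    !![a, b; c, d] - !![a', b'; c', d'] = !![a - a', b - b'; c - c', d - d'] := by
  ext i j; fin_cases i <;> fin_cases j <;> simp

/-! ## §12.3: the times, the Hamiltonian `H₀`, the fundamental solution `W(t,z)` -/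

/-- `t₀ := 0`. [cite: Suzuki2023SimplestScrew, §12.3] -/
def t₀ : ℝ := 0

/-- `t₁ := ½`. [cite: Suzuki2023SimplestScrew, §12.3] -/
def t₁ : ℝ := 1 / 2

/-- `t₂ := ½ + 4`. [cite: Suzuki2023SimplestScrew, §12.3] -/
def t₂ : ℝ := 1 / 2 + 4

/-- `t₃ := ½ + 4 + ½`. [cite: Suzuki2023SimplestScrew, §12.3] -/
def t₃ : ℝ := 1 / 2 + 4 + 1 / 2

/-- `t₂ = 9/2`, `t₃ = 5` (so `I₀ = [t₀, t₃] = [0, 5]`), and `t_k = t_{k−1} + (αₖ + γₖ)` with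
`αₖ + γₖ = ½, 4, ½`. [cite: Suzuki2023SimplestScrew, §12.2–§12.3] -/
theorem t_values : t₀ = 0 ∧ t₁ = t₀ + (0 + 1 / 2) ∧ t₂ = 9 / 2 ∧ t₂ = t₁ + (4 + 0) ∧ t₃ = 5 ∧
    t₃ = t₂ + (0 + 1 / 2) := by
  unfold t₀ t₁ t₂ t₃; norm_num

/-- `t₀ < t₁`. [cite: Suzuki2023SimplestScrew, §12.3] -/
lemma t₀_lt_t₁ : t₀ < t₁ := by unfold t₀ t₁; norm_num
/-- `t₁ < t₂`. [cite: Suzuki2023SimplestScrew, §12.3] -/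
lemma t₁_lt_t₂ : t₁ < t₂ := by unfold t₁ t₂; norm_num
/-- `t₂ < t₃`. [cite: Suzuki2023SimplestScrew, §12.3] -/
lemma t₂_lt_t₃ : t₂ < t₃ := by unfold t₂ t₃; norm_num
/-- `t₁ = ½` as a complex number. [cite: Suzuki2023SimplestScrew, §12.3] -/
lemma t₁_cast : (t₁ : ℂ) = 1 / 2 := by unfold t₁; push_cast; ring
/-- `t₂ = 9/2` as a complex number. [cite: Suzuki2023SimplestScrew, §12.3] -/
lemma t₂_cast : (t₂ : ℂ) = 9 / 2 := by unfold t₂; push_cast; ring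
/-- `t₃ = 5` as a complex number. [cite: Suzuki2023SimplestScrew, §12.3] -/
lemma t₃_cast : (t₃ : ℂ) = 5 := by unfold t₃; push_cast; ring

/-- `diag(0, 1)`: the Hamiltonian of an indivisible interval of type `π/2`.
[cite: Suzuki2023SimplestScrew, §12.3] -/
def Hhalfpi : Matrix (Fin 2) (Fin 2) ℂ := !![0, 0; 0, 1]

/-- `diag(1, 0)`: the Hamiltonian of an indivisible interval of type `0`.
[cite: Suzuki2023SimplestScrew, §12.3] -/
def Hzero : Matrix (Fin 2) (Fin 2) ℂ := !![1, 0; 0, 0]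

/-- The normalisation `H = [[α,β],[β,γ]]/(α+γ)` of §12.2 for the factor data of §12.3:
`diag(0,1) = diag(0,½)/(0+½)`, `diag(1,0) = diag(4,0)/(4+0)`.
[cite: Suzuki2023SimplestScrew, §12.2–§12.3] -/
theorem H_normalisation :
    Hhalfpi = (1 / (0 + 1 / 2) : ℂ) • N₁ ∧ Hzero = (1 / (4 + 0) : ℂ) • N₂ := by
  rw [Hhalfpi, Hzero, N₁, N₂, smul_mat2, smul_mat2]
  exact ⟨mat2_ext (by ring) (by ring) (by ring) (by ring),
    mat2_ext (by ring) (by ring) (by ring) (by ring)⟩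

/-- The Hamiltonian `H₀` of (12.7): `diag(0,1)` on `t₀ ≤ t < t₁` and `t₂ ≤ t ≤ t₃`, `diag(1,0)` on
`t₁ ≤ t < t₂` (real symmetric rank-one projections of trace `1` — «clearly `H₀` is a Hamiltonian on
`I₀ = [0,5]`»); extended by `diag(0,1)` outside `[0,5]` (junk, documented).
[cite: Suzuki2023SimplestScrew, §12.3 eq. (12.7)] -/
def H₀ (t : ℝ) : Matrix (Fin 2) (Fin 2) ℂ :=
  if t₁ ≤ t ∧ t < t₂ then Hzero else Hhalfpi

/-- `H₀ = diag(0,1)` on `t < t₁`. [cite: Suzuki2023SimplestScrew, §12.3 eq. (12.7)] -/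
lemma H₀_of_lt₁ {t : ℝ} (h : t < t₁) : H₀ t = Hhalfpi := by
  simp [H₀, not_le.mpr h]

/-- `H₀ = diag(1,0)` on `t₁ ≤ t < t₂`. [cite: Suzuki2023SimplestScrew, §12.3 eq. (12.7)] -/
lemma H₀_of_mem₂ {t : ℝ} (h₁ : t₁ ≤ t) (h₂ : t < t₂) : H₀ t = Hzero := by
  simp [H₀, h₁, h₂]

/-- `H₀ = diag(0,1)` on `t₂ ≤ t`. [cite: Suzuki2023SimplestScrew, §12.3 eq. (12.7)] -/
lemma H₀_of_le₃ {t : ℝ} (h : t₂ ≤ t) : H₀ t = Hhalfpi := by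
  simp [H₀, not_lt.mpr h]

/-- Printed `A(t,z)`: `1` on `[t₀,t₁)`, `1` on `[t₁,t₂)`, `1 + (18 − 4t)z²` on `[t₂,t₃]`.
[cite: Suzuki2023SimplestScrew, §12.3] -/
def Asol (t : ℝ) (z : ℂ) : ℂ :=
  if t < t₁ then 1 else if t < t₂ then 1 else 1 + (18 - 4 * (t : ℂ)) * z ^ 2

/-- Printed `B(t,z)`: `0`, `(t − ½)z`, `4z`. [cite: Suzuki2023SimplestScrew, §12.3] -/
def Bsol (t : ℝ) (z : ℂ) : ℂ :=
  if t < t₁ then 0 else if t < t₂ then ((t : ℂ) - 1 / 2) * z else 4 * z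

/-- Printed `C(t,z)`: `−tz`, `−z/2`, `(2t − 9)z³ − (t − 4)z`. [cite: Suzuki2023SimplestScrew, §12.3] -/
def Csol (t : ℝ) (z : ℂ) : ℂ :=
  if t < t₁ then -(t : ℂ) * z
  else if t < t₂ then -(1 / 2 : ℂ) * z else (2 * (t : ℂ) - 9) * z ^ 3 - ((t : ℂ) - 4) * z

/-- Printed `D(t,z)`: `1`, `1 + ¼(1 − 2t)z²`, `1 − 2z²`. [cite: Suzuki2023SimplestScrew, §12.3] -/
def Dsol (t : ℝ) (z : ℂ) : ℂ :=
  if t < t₁ then 1 else if t < t₂ then 1 + (1 / 4 : ℂ) * (1 - 2 * (t : ℂ)) * z ^ 2 else 1 - 2 * z ^ 2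

/-- `W(t,z) = [[A(t,z), B(t,z)], [C(t,z), D(t,z)]]`. [cite: Suzuki2023SimplestScrew, §12.3] -/
def W (t : ℝ) (z : ℂ) : Matrix (Fin 2) (Fin 2) ℂ := !![Asol t z, Bsol t z; Csol t z, Dsol t z]

/-- `E₀(t,z) := C(t,z) − iD(t,z)`. [cite: Suzuki2023SimplestScrew, §12.3] -/
def Esol (t : ℝ) (z : ℂ) : ℂ := Csol t z - I * Dsol t z

/-- The printed first branch (`t₀ ≤ t < t₁`) of `W(t,z)`, literally.
[cite: Suzuki2023SimplestScrew, §12.3] -/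
theorem W_of_lt₁ {t : ℝ} (h : t < t₁) (z : ℂ) : W t z = !![1, 0; -(t : ℂ) * z, 1] := by
  simp [W, Asol, Bsol, Csol, Dsol, h]

/-- The printed second branch (`t₁ ≤ t < t₂`) of `W(t,z)`, literally.
[cite: Suzuki2023SimplestScrew, §12.3] -/
theorem W_of_mem₂ {t : ℝ} (h₁ : t₁ ≤ t) (h₂ : t < t₂) (z : ℂ) :
    W t z = !![1, ((t : ℂ) - 1 / 2) * z;
      -(1 / 2 : ℂ) * z, 1 + (1 / 4 : ℂ) * (1 - 2 * (t : ℂ)) * z ^ 2] := by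
  have h₁' : ¬ t < t₁ := not_lt.mpr h₁
  simp [W, Asol, Bsol, Csol, Dsol, h₁', h₂]

/-- The printed third branch (`t₂ ≤ t ≤ t₃`) of `W(t,z)`, literally.
[cite: Suzuki2023SimplestScrew, §12.3] -/
theorem W_of_le₃ {t : ℝ} (h : t₂ ≤ t) (z : ℂ) :
    W t z = !![1 + (18 - 4 * (t : ℂ)) * z ^ 2, 4 * z;
      (2 * (t : ℂ) - 9) * z ^ 3 - ((t : ℂ) - 4) * z, 1 - 2 * z ^ 2] := by
  have h₁ : ¬ t < t₁ := not_lt.mpr (t₁_lt_t₂.le.trans h)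
  have h₂ : ¬ t < t₂ := not_lt.mpr h
  simp [W, Asol, Bsol, Csol, Dsol, h₁, h₂]

/-- Type-`π/2` step of (12.6), literally: `I − c·diag(0,1)J = [[1, 0], [−c, 1]]`.
[cite: Suzuki2023SimplestScrew, eq. (12.6)] -/
theorem one_sub_smul_Hhalfpi_mul_J (c : ℂ) :
    (1 : Matrix (Fin 2) (Fin 2) ℂ) - c • (Hhalfpi * J) = !![1, 0; -c, 1] := by
  rw [Hhalfpi, J, Matrix.mul_fin_two, smul_mat2, Matrix.one_fin_two, sub_mat2]
  exact mat2_ext (by ring) (by ring) (by ring) (by ring)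

/-- Type-`0` step of (12.6), literally: `I − c·diag(1,0)J = [[1, c], [0, 1]]`.
[cite: Suzuki2023SimplestScrew, eq. (12.6)] -/
theorem one_sub_smul_Hzero_mul_J (c : ℂ) :
    (1 : Matrix (Fin 2) (Fin 2) ℂ) - c • (Hzero * J) = !![1, c; 0, 1] := by
  rw [Hzero, J, Matrix.mul_fin_two, smul_mat2, Matrix.one_fin_two, sub_mat2]
  exact mat2_ext (by ring) (by ring) (by ring) (by ring)

/-- **(12.6), step 1**: for `t < t₁`, `W(t,z) = W(t₀,z)(I − z(t − t₀)·diag(0,1)J) = I − zt·diag(0,1)J`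
(`W(t₀) = I`, `t₀ = 0`). [cite: Suzuki2023SimplestScrew, eq. (12.6), §12.3] -/
theorem W_eq_step₁ {t : ℝ} (ht : t < t₁) (z : ℂ) :
    W t z = 1 - (z * (t : ℂ)) • (Hhalfpi * J) := by
  rw [W_of_lt₁ ht, one_sub_smul_Hhalfpi_mul_J]
  exact mat2_ext (by ring) (by ring) (by ring) (by ring)

/-- `W(t₁, z) = [[1, 0], [−z/2, 1]]`. [cite: Suzuki2023SimplestScrew, §12.3] -/
theorem W_t₁ (z : ℂ) : W t₁ z = !![1, 0; -(1 / 2 : ℂ) * z, 1] := by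
  rw [W_of_mem₂ le_rfl t₁_lt_t₂, t₁_cast]
  exact mat2_ext (by ring) (by ring) (by ring) (by ring)

/-- Continuity at `t₁`: the first-branch formula evaluated at `t₁` IS `W(t₁,z)`.
[cite: Suzuki2023SimplestScrew, §12.3] -/
theorem W_t₁_eq_left (z : ℂ) : W t₁ z = 1 - (z * (t₁ : ℂ)) • (Hhalfpi * J) := by
  rw [W_t₁, one_sub_smul_Hhalfpi_mul_J, t₁_cast]
  exact mat2_ext (by ring) (by ring) (by ring) (by ring)

/-- **(12.6), step 2**: for `t₁ ≤ t < t₂`, `W(t,z) = W(t₁,z)(I − z(t − t₁)·diag(1,0)J)`.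
[cite: Suzuki2023SimplestScrew, eq. (12.6), §12.3] -/
theorem W_eq_step₂ {t : ℝ} (ht₁ : t₁ ≤ t) (ht₂ : t < t₂) (z : ℂ) :
    W t z = W t₁ z * (1 - (z * ((t : ℂ) - t₁)) • (Hzero * J)) := by
  rw [W_of_mem₂ ht₁ ht₂, W_t₁, one_sub_smul_Hzero_mul_J, Matrix.mul_fin_two, t₁_cast]
  exact mat2_ext (by ring) (by ring) (by ring) (by ring)

/-- `W(t₂, z) = [[1, 4z], [−z/2, 1 − 2z²]]`. [cite: Suzuki2023SimplestScrew, §12.3] -/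
theorem W_t₂ (z : ℂ) : W t₂ z = !![1, 4 * z; -(1 / 2 : ℂ) * z, 1 - 2 * z ^ 2] := by
  rw [W_of_le₃ le_rfl, t₂_cast]
  exact mat2_ext (by ring) (by ring) (by ring) (by ring)

/-- Continuity at `t₂`: the second-branch formula evaluated at `t₂` IS `W(t₂,z)`.
[cite: Suzuki2023SimplestScrew, §12.3] -/
theorem W_t₂_eq_left (z : ℂ) :
    W t₂ z = W t₁ z * (1 - (z * ((t₂ : ℂ) - t₁)) • (Hzero * J)) := by
  rw [W_t₂, W_t₁, one_sub_smul_Hzero_mul_J, Matrix.mul_fin_two, t₁_cast, t₂_cast]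
  exact mat2_ext (by ring) (by ring) (by ring) (by ring)

/-- **(12.6), step 3**: for `t₂ ≤ t`, `W(t,z) = W(t₂,z)(I − z(t − t₂)·diag(0,1)J)`.
[cite: Suzuki2023SimplestScrew, eq. (12.6), §12.3] -/
theorem W_eq_step₃ {t : ℝ} (ht : t₂ ≤ t) (z : ℂ) :
    W t z = W t₂ z * (1 - (z * ((t : ℂ) - t₂)) • (Hhalfpi * J)) := by
  rw [W_of_le₃ ht, W_t₂, one_sub_smul_Hhalfpi_mul_J, Matrix.mul_fin_two, t₂_cast]
  exact mat2_ext (by ring) (by ring) (by ring) (by ring)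

/-- **Initial value** of (12.5): `W(0, z) = I`. [cite: Suzuki2023SimplestScrew, eq. (12.5), §12.3] -/
theorem W_zero (z : ℂ) : W 0 z = 1 := by
  rw [W_of_lt₁ (show (0 : ℝ) < t₁ from t₀_lt_t₁), Matrix.one_fin_two]
  exact mat2_ext (by ring) (by ring) (by simp) (by ring)

/-- **Terminal value**: `W(t₃, z) = W₀(z)` — the fundamental solution recovers `W₀`.
[cite: Suzuki2023SimplestScrew, §12.3] -/
theorem W_t₃ (z : ℂ) : W t₃ z = W₀ z := by
  rw [W_of_le₃ t₂_lt_t₃.le, t₃_cast, W₀]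
  unfold A B C D
  exact mat2_ext (by ring) (by ring) (by ring) (by ring)

/-- `det W(t,z) = 1` for every `t` (each factor of (12.6) is unimodular).
[cite: Suzuki2023SimplestScrew, §12.2–§12.3] -/
theorem det_W (t : ℝ) (z : ℂ) : (W t z).det = 1 := by
  rw [W, Matrix.det_fin_two_of]
  unfold Asol Bsol Csol Dsol
  split_ifs <;> ring

/-- The derivative of an entry of an affine matrix path `r ↦ P + r·Q` is the entry of `Q`.
[folklore] -/
private theorem hasDerivAt_affine_entry (P Q : Matrix (Fin 2) (Fin 2) ℂ) (i j : Fin 2) (s : ℝ) :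
    HasDerivAt (fun r : ℝ => (P + (r : ℂ) • Q) i j) (Q i j) s := by
  simp only [Matrix.add_apply, Matrix.smul_apply, smul_eq_mul]
  have h : HasDerivAt (fun r : ℝ => (r : ℂ)) 1 s := by
    simpa using (hasDerivAt_id s).ofReal_comp
  simpa using (h.mul_const (Q i j)).const_add (P i j)

/-- On `t < t₁`: `W(s,z)J = [[0,−1],[1,0]] + s·[[0,0],[0,z]]` (affine in `s`).
[cite: Suzuki2023SimplestScrew, §12.3] -/
theorem W_mul_J_affine₁ {s : ℝ} (hs : s < t₁) (z : ℂ) :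
    W s z * J = !![0, -1; 1, 0] + (s : ℂ) • !![0, 0; 0, z] := by
  rw [W_of_lt₁ hs, J, Matrix.mul_fin_two, smul_mat2, add_mat2]
  exact mat2_ext (by ring) (by ring) (by ring) (by ring)

/-- On `t < t₁`: `z·W(t,z)H₀(t) = [[0,0],[0,z]]`. [cite: Suzuki2023SimplestScrew, §12.3] -/
theorem smul_W_mul_H₀₁ {t : ℝ} (ht : t < t₁) (z : ℂ) :
    z • (W t z * H₀ t) = !![0, 0; 0, z] := by
  rw [H₀_of_lt₁ ht, W_of_lt₁ ht, Hhalfpi, Matrix.mul_fin_two, smul_mat2]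
  exact mat2_ext (by ring) (by ring) (by ring) (by ring)

/-- On `t₁ ≤ s < t₂`: `W(s,z)J = [[−z/2, −1],[1 + z²/4, z/2]] + s·[[z, 0],[−z²/2, 0]]`.
[cite: Suzuki2023SimplestScrew, §12.3] -/
theorem W_mul_J_affine₂ {s : ℝ} (h₁ : t₁ ≤ s) (h₂ : s < t₂) (z : ℂ) :
    W s z * J = !![-(1 / 2 : ℂ) * z, -1; 1 + z ^ 2 / 4, (1 / 2 : ℂ) * z] +
      (s : ℂ) • !![z, 0; -(z ^ 2 / 2), 0] := by
  rw [W_of_mem₂ h₁ h₂, J, Matrix.mul_fin_two, smul_mat2, add_mat2]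
  exact mat2_ext (by ring) (by ring) (by ring) (by ring)

/-- On `t₁ ≤ t < t₂`: `z·W(t,z)H₀(t) = [[z, 0],[−z²/2, 0]]`. [cite: Suzuki2023SimplestScrew, §12.3] -/
theorem smul_W_mul_H₀₂ {t : ℝ} (h₁ : t₁ ≤ t) (h₂ : t < t₂) (z : ℂ) :
    z • (W t z * H₀ t) = !![z, 0; -(z ^ 2 / 2), 0] := by
  rw [H₀_of_mem₂ h₁ h₂, W_of_mem₂ h₁ h₂, Hzero, Matrix.mul_fin_two, smul_mat2]
  exact mat2_ext (by ring) (by ring) (by ring) (by ring)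

/-- On `t₂ ≤ s`: `W(s,z)J = [[4z, −1 − 18z²],[1 − 2z², 9z³ − 4z]] + s·[[0, 4z²],[0, z − 2z³]]`.
[cite: Suzuki2023SimplestScrew, §12.3] -/
theorem W_mul_J_affine₃ {s : ℝ} (hs : t₂ ≤ s) (z : ℂ) :
    W s z * J = !![4 * z, -1 - 18 * z ^ 2; 1 - 2 * z ^ 2, 9 * z ^ 3 - 4 * z] +
      (s : ℂ) • !![0, 4 * z ^ 2; 0, z - 2 * z ^ 3] := by
  rw [W_of_le₃ hs, J, Matrix.mul_fin_two, smul_mat2, add_mat2]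
  exact mat2_ext (by ring) (by ring) (by ring) (by ring)

/-- On `t₂ ≤ t`: `z·W(t,z)H₀(t) = [[0, 4z²],[0, z − 2z³]]`. [cite: Suzuki2023SimplestScrew, §12.3] -/
theorem smul_W_mul_H₀₃ {t : ℝ} (ht : t₂ ≤ t) (z : ℂ) :
    z • (W t z * H₀ t) = !![0, 4 * z ^ 2; 0, z - 2 * z ^ 3] := by
  rw [H₀_of_le₃ ht, W_of_le₃ ht, Hhalfpi, Matrix.mul_fin_two, smul_mat2]
  exact mat2_ext (by ring) (by ring) (by ring) (by ring)

/-- **(12.5) on `(t₀, t₁)`**: `(d/dt)[W(t,z)J] = z·W(t,z)H₀(t)`, entrywise.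
[cite: Suzuki2023SimplestScrew, eq. (12.5), §12.3] -/
theorem hasDerivAt_W_mul_J_Ioo₁ {t : ℝ} (ht : t ∈ Set.Ioo t₀ t₁) (z : ℂ) (i j : Fin 2) :
    HasDerivAt (fun s : ℝ => (W s z * J) i j) ((z • (W t z * H₀ t)) i j) t := by
  have hev : (fun s : ℝ => (W s z * J) i j) =ᶠ[nhds t]
      (fun s : ℝ => ((!![0, -1; 1, 0] + (s : ℂ) • !![0, 0; 0, z] :
        Matrix (Fin 2) (Fin 2) ℂ)) i j) := by
    filter_upwards [Iio_mem_nhds ht.2] with s hs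
    rw [W_mul_J_affine₁ hs]
  rw [smul_W_mul_H₀₁ ht.2]
  exact (hasDerivAt_affine_entry _ _ i j t).congr_of_eventuallyEq hev

/-- **(12.5) on `(t₁, t₂)`**, entrywise. [cite: Suzuki2023SimplestScrew, eq. (12.5), §12.3] -/
theorem hasDerivAt_W_mul_J_Ioo₂ {t : ℝ} (ht : t ∈ Set.Ioo t₁ t₂) (z : ℂ) (i j : Fin 2) :
    HasDerivAt (fun s : ℝ => (W s z * J) i j) ((z • (W t z * H₀ t)) i j) t := by
  have hev : (fun s : ℝ => (W s z * J) i j) =ᶠ[nhds t]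
      (fun s : ℝ => ((!![-(1 / 2 : ℂ) * z, -1; 1 + z ^ 2 / 4, (1 / 2 : ℂ) * z] +
        (s : ℂ) • !![z, 0; -(z ^ 2 / 2), 0] : Matrix (Fin 2) (Fin 2) ℂ)) i j) := by
    filter_upwards [Ioi_mem_nhds ht.1, Iio_mem_nhds ht.2] with s hs₁ hs₂
    rw [W_mul_J_affine₂ (le_of_lt hs₁) hs₂]
  rw [smul_W_mul_H₀₂ ht.1.le ht.2]
  exact (hasDerivAt_affine_entry _ _ i j t).congr_of_eventuallyEq hev

/-- **(12.5) on `(t₂, t₃)`** (indeed at every `t > t₂`), entrywise.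
[cite: Suzuki2023SimplestScrew, eq. (12.5), §12.3] -/
theorem hasDerivAt_W_mul_J_Ioo₃ {t : ℝ} (ht : t ∈ Set.Ioo t₂ t₃) (z : ℂ) (i j : Fin 2) :
    HasDerivAt (fun s : ℝ => (W s z * J) i j) ((z • (W t z * H₀ t)) i j) t := by
  have hev : (fun s : ℝ => (W s z * J) i j) =ᶠ[nhds t]
      (fun s : ℝ => ((!![4 * z, -1 - 18 * z ^ 2; 1 - 2 * z ^ 2, 9 * z ^ 3 - 4 * z] +
        (s : ℂ) • !![0, 4 * z ^ 2; 0, z - 2 * z ^ 3] : Matrix (Fin 2) (Fin 2) ℂ)) i j) := by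
    filter_upwards [Ioi_mem_nhds ht.1] with s hs
    rw [W_mul_J_affine₃ (le_of_lt hs)]
  rw [smul_W_mul_H₀₃ ht.1.le]
  exact (hasDerivAt_affine_entry _ _ i j t).congr_of_eventuallyEq hev

/-- The regular points are `{t₀, t₁, t₂, t₃}`: at every other point of `(t₀, t₃)` the canonical
system (12.5) holds for `H = H₀` (union of the three interval statements).
[cite: Suzuki2023SimplestScrew, eq. (12.5), §12.3] -/
theorem hasDerivAt_W_mul_J {t : ℝ} (ht : t ∈ Set.Ioo t₀ t₃) (ht₁ : t ≠ t₁) (ht₂ : t ≠ t₂)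
    (z : ℂ) (i j : Fin 2) :
    HasDerivAt (fun s : ℝ => (W s z * J) i j) ((z • (W t z * H₀ t)) i j) t := by
  rcases lt_or_gt_of_ne ht₁ with h₁ | h₁
  · exact hasDerivAt_W_mul_J_Ioo₁ ⟨ht.1, h₁⟩ z i j
  rcases lt_or_gt_of_ne ht₂ with h₂ | h₂
  · exact hasDerivAt_W_mul_J_Ioo₂ ⟨h₁, h₂⟩ z i j
  · exact hasDerivAt_W_mul_J_Ioo₃ ⟨h₂, ht.2⟩ z i j

/-- `C(t₀,z) = 0`. [cite: Suzuki2023SimplestScrew, §12.3] -/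
lemma Csol_t₀ (z : ℂ) : Csol t₀ z = 0 := by
  rw [Csol, if_pos t₀_lt_t₁]; simp [t₀]
/-- `D(t₀,z) = 1`. [cite: Suzuki2023SimplestScrew, §12.3] -/
lemma Dsol_t₀ (z : ℂ) : Dsol t₀ z = 1 := by simp [Dsol, t₀_lt_t₁]
/-- `C(t₁,z) = −z/2`. [cite: Suzuki2023SimplestScrew, §12.3] -/
lemma Csol_t₁ (z : ℂ) : Csol t₁ z = -(1 / 2 : ℂ) * z := by simp [Csol, t₁_lt_t₂]
/-- `D(t₁,z) = 1`. [cite: Suzuki2023SimplestScrew, §12.3] -/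
lemma Dsol_t₁ (z : ℂ) : Dsol t₁ z = 1 := by simp [Dsol, t₁_lt_t₂, t₁_cast]
/-- `C(t₂,z) = −z/2`. [cite: Suzuki2023SimplestScrew, §12.3] -/
lemma Csol_t₂ (z : ℂ) : Csol t₂ z = -(1 / 2 : ℂ) * z := by
  have h : ¬ t₂ < t₁ := not_lt.mpr t₁_lt_t₂.le
  simp [Csol, h, t₂_cast]; ring
/-- `D(t₂,z) = 1 − 2z²`. [cite: Suzuki2023SimplestScrew, §12.3] -/
lemma Dsol_t₂ (z : ℂ) : Dsol t₂ z = 1 - 2 * z ^ 2 := by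
  have h : ¬ t₂ < t₁ := not_lt.mpr t₁_lt_t₂.le
  simp [Dsol, h]
/-- `C(t₃,z) = z³ − z = C(z)`. [cite: Suzuki2023SimplestScrew, §12.3] -/
lemma Csol_t₃ (z : ℂ) : Csol t₃ z = z ^ 3 - z := by
  have h₁ : ¬ t₃ < t₁ := not_lt.mpr (t₁_lt_t₂.le.trans t₂_lt_t₃.le)
  have h₂ : ¬ t₃ < t₂ := not_lt.mpr t₂_lt_t₃.le
  simp [Csol, h₁, h₂, t₃_cast]; ring
/-- `D(t₃,z) = 1 − 2z² = D(z)`. [cite: Suzuki2023SimplestScrew, §12.3] -/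
lemma Dsol_t₃ (z : ℂ) : Dsol t₃ z = 1 - 2 * z ^ 2 := by
  have h₁ : ¬ t₃ < t₁ := not_lt.mpr (t₁_lt_t₂.le.trans t₂_lt_t₃.le)
  have h₂ : ¬ t₃ < t₂ := not_lt.mpr t₂_lt_t₃.le
  simp [Dsol, h₁, h₂]

/-- The chain of structure functions `E₀(t_k, z) = C(t_k,z) − iD(t_k,z)` from the printed `C, D`:
`E₀(t₃,·) = E₀`, `E₀(t₂,z) = −z/2 − i(1 − 2z²)`, `E₀(t₁,z) = −z/2 − i`, `E₀(t₀,z) = −i` (the source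
prints `E₀(z)`, `−z/2 + (2z²−1)`, `−z/2 + i`, `1` — see the module docstring on these misprints).
[cite: Suzuki2023SimplestScrew, §12.3] -/
theorem Esol_values (z : ℂ) :
    Esol t₃ z = E₀ z ∧ Esol t₂ z = -(1 / 2 : ℂ) * z - I * (1 - 2 * z ^ 2) ∧
      Esol t₁ z = -(1 / 2 : ℂ) * z - I ∧ Esol t₀ z = -I := by
  refine ⟨?_, ?_, ?_, ?_⟩
  · rw [Esol, Csol_t₃, Dsol_t₃, E₀_eq_C_sub_I_D, C, D]
  · rw [Esol, Csol_t₂, Dsol_t₂]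
  · rw [Esol, Csol_t₁, Dsol_t₁, mul_one]
  · rw [Esol, Csol_t₀, Dsol_t₀, mul_one, zero_sub]

end SimplestScrewCubic

end Literature.Analysis.DeBrangesSpaces

end
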